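import Summits.Ventures.Crystal3D.Theorems.StickyWulffConstantTextureLiminfTexShadowSteepPlateDefs
import Summits.Ventures.Crystal3D.Theorems.StickyWulffConstantGenericWallFloorBarlowMachineStep
import HarnessLib

/-!
# TexShadow row (e) / EDGE-ON (ε₂): NOT STEEP ⇒ LAUNCHABLE, part 1 — coordinates, the capper-floor inequality, the explicit steering
# (lane T, crux `TextureLiminfV5`, stmt-Ventures-23912, sub-crux EDGE-ON; cf-p1 DECISION (cxxxvii)(2)(b); memo HOME/wall-p1-g15/STEEP-PLATE-g15.md §2)

HONEST FRAMING. Venture `Summits/Ventures/Crystal3D` (cell `crystal3d-full`), route `route-Ventures-StickyWulffConstant`, helper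
`--supports` the law-v5 crux `TextureLiminfV5` (stmt-Ventures-23912).  PROOFS ONLY (elementary real geometry); NO certificate is asserted;
nothing about any wall law is proved; rung F-C1 not moved.

THE POINT.  `…TexShadowSteepPlateDefs` (p706442) typed the EDGE-ON corner `SteepPlateAt c L e` and proved «steep ⇒ no launch».  The converse
«not steep ⇒ launchable» (`…TexShadowSteepPlateLaunch`, part 2) needs three elementary ingredients, proved here:
* coordinates of the reference up-slots and of `⟪basalMirror ·, ·⟫` (`upSlotᵢ_coord`, `inner_upSlot_fin3`,
  `inner_basalMirror_upSlot_fin3`, the table `inner_basalMirror_upSlot_upSlot`: `⟪M uᵢ, u_k⟫ = g_{ik} − 2/3`, `g_{kk} = 1/3`, `g_{ik} = −1/6`);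
* **`capperFloor_core`** — the real inequality behind the ∇-CAPPER FLOOR: for the projections `P_i = ⟪p_i, ν_h⟫` of a unit axis (`ΣP = 0`,
  `2ΣP² + h² = 1`, `h ≥ 0`), a slot `k` rising by `≥ t ≥ 1/4` and weights `λ ≥ 0 < μ`, the index minimising `λ g_{ik} + μ P_i` has capper rise
  `√(2/3) h − P ≥ 1/4` (case `k`: summing the two comparisons gives `P_k ≤ 0`; case `a ≠ k`: `P_a ≤ P_b`, then either `P_k ≤ 0` and the rise is
  `≥ t`, or `P_a ≤ −|P_b|`, `h² ≥ 1 − 12P_a²` and the rise is `≥ 1/(2√3)`);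
* **`chord_sq_le_of_steerSteepCos_le`** / **`exists_model_steering`** — the explicit steering: for unit `v, ν` with `r = ⟪v, ν⟫ ≥ steerSteepCos c ≥ 0`
  the unit `ζ := ν` (`r ≥ √2/2`) resp. `ζ := √2/2·v + (√2/2)/√(1−r²)·(ν − r v)` (the point of `v`'s `45°`-circle nearest to `ν`) satisfies
  `‖ζ − ν‖ ≤ c` and `⟪v, ζ⟫ ≥ √2/2`, and `ζ = α v + β ν` with `α ≥ 0 < β` (`t = cos(45°+θ_c)`, `t' = sin(45°+θ_c)`, `r + √(1−r²) ≥ t + t' = √2 cos θ_c`).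
Also `steerSteepCos_third_ge_quarter` / `steerSteepCos_quarter_ge_quarter` (`1/4 ≤ steerSteepCos c` at the chords of record).
WHAT THIS IS NOT: no coverage certificate; F-C1 not moved.
-/

noncomputable section

open scoped BigOperators InnerProductSpace ENNReal
open MeasureTheory Filter

namespace Summit.Ventures.Crystal3D.Cruxes.TextureLiminf.TexShadow

open Summit.Ventures.Crystal3D Summit.Ventures.Crystal3D.Theorems
open Literature.MathematicalPhysics.StatisticalMechanics (IsHaggSeq fccStacking barlowStacking basalMirror barlowPos_apply_zero
  barlowPos_apply_one barlowPos_apply_two basalMirror_apply_coord)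

/-! ## Numeric facts about the thresholds -/

/-- `1/4 ≤ steerSteepCos (1/3)` (`(17√2 − √70)/36 ≈ 0.4354`). -/
theorem steerSteepCos_third_ge_quarter : (1 / 4 : ℝ) ≤ steerSteepCos (1 / 3) := by
  rw [steerSteepCos_third]
  have h2 : (1.414 : ℝ) ≤ Real.sqrt 2 := by
    rw [show (1.414 : ℝ) = Real.sqrt (1.414 ^ 2) by rw [Real.sqrt_sq (by norm_num)]]
    exact Real.sqrt_le_sqrt (by norm_num)
  have h70 : Real.sqrt 70 ≤ 8.37 := by
    rw [show (8.37 : ℝ) = Real.sqrt (8.37 ^ 2) by rw [Real.sqrt_sq (by norm_num)]]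
    exact Real.sqrt_le_sqrt (by norm_num)
  linarith

/-- `1/4 ≤ steerSteepCos (1/4)` (`(31√2 − 3√14)/64 ≈ 0.5096`). -/
theorem steerSteepCos_quarter_ge_quarter : (1 / 4 : ℝ) ≤ steerSteepCos (1 / 4) := by
  rw [steerSteepCos_quarter]
  have h2 : (1.414 : ℝ) ≤ Real.sqrt 2 := by
    rw [show (1.414 : ℝ) = Real.sqrt (1.414 ^ 2) by rw [Real.sqrt_sq (by norm_num)]]
    exact Real.sqrt_le_sqrt (by norm_num)
  have h14 : Real.sqrt 14 ≤ 3.75 := by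
    rw [show (3.75 : ℝ) = Real.sqrt (3.75 ^ 2) by rw [Real.sqrt_sq (by norm_num)]]
    exact Real.sqrt_le_sqrt (by norm_num)
  linarith

/-! ## Coordinates -/

/-- Coordinates of `upSlot₁ = (½, √3/6, √(2/3))`. -/
theorem upSlot₁_coord : upSlot₁ 0 = 1 / 2 ∧ upSlot₁ 1 = Real.sqrt 3 / 6 ∧ upSlot₁ 2 = Real.sqrt (2 / 3) := by
  refine ⟨?_, ?_, ?_⟩
  · simp [upSlot₁, barlowPos_apply_zero]
  · simp [upSlot₁, barlowPos_apply_one]; ring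
  · simp [upSlot₁, barlowPos_apply_two]

/-- Coordinates of `upSlot₂ = (−½, √3/6, √(2/3))`. -/
theorem upSlot₂_coord : upSlot₂ 0 = -(1 / 2) ∧ upSlot₂ 1 = Real.sqrt 3 / 6 ∧ upSlot₂ 2 = Real.sqrt (2 / 3) := by
  refine ⟨?_, ?_, ?_⟩ <;> simp [upSlot₂, barlowPos_apply_zero, barlowPos_apply_one, barlowPos_apply_two] <;> ring

/-- Coordinates of `upSlot₃ = (0, −√3/3, √(2/3))`. -/
theorem upSlot₃_coord : upSlot₃ 0 = 0 ∧ upSlot₃ 1 = -(Real.sqrt 3 / 3) ∧ upSlot₃ 2 = Real.sqrt (2 / 3) := by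
  refine ⟨?_, ?_, ?_⟩ <;> simp [upSlot₃, barlowPos_apply_zero, barlowPos_apply_one, barlowPos_apply_two] <;> ring

/-- `⟪basalMirror w, ν⟫` in coordinates. -/
theorem inner_basalMirror_fin3 (w ν : E3) : ⟪basalMirror w, ν⟫_ℝ = w 0 * ν 0 + w 1 * ν 1 - w 2 * ν 2 := by
  have h : ∀ a b : E3, ⟪a, b⟫_ℝ = a 0 * b 0 + a 1 * b 1 + a 2 * b 2 := fun a b => by
    simp [PiLp.inner_apply, Fin.sum_univ_three, mul_comm]
  rw [h, basalMirror_apply_coord, basalMirror_apply_coord, basalMirror_apply_coord]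
  simp; ring

/-! ## The capper floor, core inequality -/

/-- **Capper floor, core** (memo §2).  Three reals `Pk, Pa, Pb` (the projections `⟪p_i, ν_h⟫` of the horizontal part of a unit `ν` with
`ν₂ = h ≥ 0` on the three horizontal slot directions, `Pk + Pa + Pb = 0`, `2(Pk² + Pa² + Pb²) + h² = 1`), a threshold `t ≥ 1/4` with
`Pk + √(2/3)·h ≥ t` (slot `k` rises by `≥ t`), and weights `λ ≥ 0`, `μ > 0` (the steering's horizontal part is `λ'·p_k + μ'·ν_h`): the capper
that MINIMISES `λ·g_{ik} + μ·P_i` (`g_{kk} = 1/3`, `g_{ik} = −1/6`) rises by `≥ 1/4`: (1) if the minimiser is `k` itself, `√(2/3)h − Pk ≥ 1/4`;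
(2) if it is `a`, `√(2/3)h − Pa ≥ 1/4`. -/
theorem capperFloor_core (Pk Pa Pb h lam mu t : ℝ) (hsum : Pk + Pa + Pb = 0) (hsph : 2 * (Pk ^ 2 + Pa ^ 2 + Pb ^ 2) + h ^ 2 = 1)
    (hh : 0 ≤ h) (ht : (1 / 4 : ℝ) ≤ t) (hr : t ≤ Pk + Real.sqrt (2 / 3) * h) (hlam : 0 ≤ lam) (hmu : 0 < mu) :
    ((lam / 3 + mu * Pk ≤ -(lam / 6) + mu * Pa) → (lam / 3 + mu * Pk ≤ -(lam / 6) + mu * Pb) → (1 / 4 : ℝ) ≤ Real.sqrt (2 / 3) * h - Pk) ∧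
    ((-(lam / 6) + mu * Pa ≤ -(lam / 6) + mu * Pb) → (1 / 4 : ℝ) ≤ Real.sqrt (2 / 3) * h - Pa) := by
  have hq0 : 0 ≤ Real.sqrt (2 / 3) := Real.sqrt_nonneg _
  have hqh : 0 ≤ Real.sqrt (2 / 3) * h := mul_nonneg hq0 hh
  refine ⟨fun h1 h2 => ?_, fun h1 => ?_⟩
  · -- summing the two comparisons: `μ·Pk ≤ −λ/3 ≤ 0`, so `Pk ≤ 0`, and the rise is `≥ t`
    have hm3 : mu * Pk + mu * Pa + mu * Pb = 0 := by rw [← mul_add, ← mul_add, hsum, mul_zero]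
    have hmul : mu * Pk ≤ 0 := by linarith
    have hPk : Pk ≤ 0 := by
      by_contra hcon
      exact absurd hmul (not_le.mpr (mul_pos hmu (lt_of_not_ge hcon)))
    linarith
  · have hab : Pa ≤ Pb := le_of_mul_le_mul_left (by linarith) hmu
    rcases le_or_gt Pk 0 with hPk | hPk
    · -- `Pa + Pb ≥ 0`, so `Pb ≥ 0` and `√(2/3)h ≥ t − Pk = t + Pa + Pb`
      linarith
    · -- `Pa + Pb < 0`: `Pa ≤ −|Pb|`, `h² ≥ 1 − 12 Pa²`, and the octant bound
      have hPa : Pa ≤ 0 := by linarith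
      have hPb2 : Pb ^ 2 ≤ Pa ^ 2 := by nlinarith
      have hPk2 : Pk ^ 2 ≤ 4 * Pa ^ 2 := by nlinarith
      have hh2 : 1 - 12 * Pa ^ 2 ≤ h ^ 2 := by nlinarith
      have h3 : Real.sqrt 3 ^ 2 = 3 := Real.sq_sqrt (by norm_num)
      have h30 : 0 ≤ Real.sqrt 3 := Real.sqrt_nonneg _
      -- W := h + 2√3·(−Pa) ≥ 1
      have hW0 : 0 ≤ h + 2 * Real.sqrt 3 * (-Pa) := by
        have : 0 ≤ 2 * Real.sqrt 3 * (-Pa) := mul_nonneg (by positivity) (by linarith)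
        linarith
      have hW1 : 1 ≤ (h + 2 * Real.sqrt 3 * (-Pa)) ^ 2 := by
        have hcross : 0 ≤ h * (2 * Real.sqrt 3 * (-Pa)) := mul_nonneg hh (mul_nonneg (by positivity) (by linarith))
        have hexp : (h + 2 * Real.sqrt 3 * (-Pa)) ^ 2 = h ^ 2 + 2 * (h * (2 * Real.sqrt 3 * (-Pa))) + 4 * Real.sqrt 3 ^ 2 * Pa ^ 2 := by
          ring
        rw [hexp, h3]; nlinarith
      have hW : 1 ≤ h + 2 * Real.sqrt 3 * (-Pa) := by
        by_contra hcon
        have hlt : h + 2 * Real.sqrt 3 * (-Pa) < 1 := lt_of_not_ge hcon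
        have : (h + 2 * Real.sqrt 3 * (-Pa)) ^ 2 < 1 := by
          calc (h + 2 * Real.sqrt 3 * (-Pa)) ^ 2 = (h + 2 * Real.sqrt 3 * (-Pa)) * (h + 2 * Real.sqrt 3 * (-Pa)) := sq _
            _ ≤ 1 * (h + 2 * Real.sqrt 3 * (-Pa)) := mul_le_mul_of_nonneg_right hlt.le hW0
            _ < 1 := by linarith
        linarith
      -- `√(2/3) ≥ √3/6 ≥ 1/4`
      have hqm : Real.sqrt 3 / 6 ≤ Real.sqrt (2 / 3) := by
        rw [show Real.sqrt 3 / 6 = Real.sqrt (3 / 36) by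
          rw [Real.sqrt_div' _ (by norm_num : (0:ℝ) ≤ 36), show Real.sqrt 36 = 6 by
            rw [show (36:ℝ) = 6 ^ 2 by norm_num, Real.sqrt_sq (by norm_num)]]]
        exact Real.sqrt_le_sqrt (by norm_num)
      have hm : (1 / 4 : ℝ) ≤ Real.sqrt 3 / 6 := by
        have : (1.5 : ℝ) ≤ Real.sqrt 3 := by
          rw [show (1.5 : ℝ) = Real.sqrt (1.5 ^ 2) by rw [Real.sqrt_sq (by norm_num)]]
          exact Real.sqrt_le_sqrt (by norm_num)
        linarith
      have hid : Real.sqrt 3 / 6 * (h + 2 * Real.sqrt 3 * (-Pa)) = Real.sqrt 3 / 6 * h - Pa := by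
        linear_combination (-Pa / 3) * h3
      calc (1 / 4 : ℝ) ≤ Real.sqrt 3 / 6 := hm
        _ ≤ Real.sqrt 3 / 6 * (h + 2 * Real.sqrt 3 * (-Pa)) := le_mul_of_one_le_right (by positivity) hW
        _ = Real.sqrt 3 / 6 * h - Pa := hid
        _ ≤ Real.sqrt (2 / 3) * h - Pa := by nlinarith [mul_le_mul_of_nonneg_right hqm hh]

/-! ## Numeric inner products of the reference slots -/

/-- `⟪upSlotᵢ, w⟫` in coordinates. -/
theorem inner_upSlot_fin3 (w : E3) :
    ⟪upSlot₁, w⟫_ℝ = 1 / 2 * w 0 + Real.sqrt 3 / 6 * w 1 + Real.sqrt (2 / 3) * w 2 ∧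
    ⟪upSlot₂, w⟫_ℝ = -(1 / 2) * w 0 + Real.sqrt 3 / 6 * w 1 + Real.sqrt (2 / 3) * w 2 ∧
    ⟪upSlot₃, w⟫_ℝ = -(Real.sqrt 3 / 3) * w 1 + Real.sqrt (2 / 3) * w 2 := by
  obtain ⟨a0, a1, a2⟩ := upSlot₁_coord; obtain ⟨b0, b1, b2⟩ := upSlot₂_coord; obtain ⟨c0, c1, c2⟩ := upSlot₃_coord
  have h : ∀ a b : E3, ⟪a, b⟫_ℝ = a 0 * b 0 + a 1 * b 1 + a 2 * b 2 := fun a b => by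
    simp [PiLp.inner_apply, Fin.sum_univ_three, mul_comm]
  refine ⟨?_, ?_, ?_⟩
  · rw [h, a0, a1, a2]; try ring
  · rw [h, b0, b1, b2]; try ring
  · rw [h, c0, c1, c2]; try ring

/-- `⟪basalMirror upSlotᵢ, w⟫` in coordinates. -/
theorem inner_basalMirror_upSlot_fin3 (w : E3) :
    ⟪basalMirror upSlot₁, w⟫_ℝ = 1 / 2 * w 0 + Real.sqrt 3 / 6 * w 1 - Real.sqrt (2 / 3) * w 2 ∧
    ⟪basalMirror upSlot₂, w⟫_ℝ = -(1 / 2) * w 0 + Real.sqrt 3 / 6 * w 1 - Real.sqrt (2 / 3) * w 2 ∧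
    ⟪basalMirror upSlot₃, w⟫_ℝ = -(Real.sqrt 3 / 3) * w 1 - Real.sqrt (2 / 3) * w 2 := by
  obtain ⟨a0, a1, a2⟩ := upSlot₁_coord; obtain ⟨b0, b1, b2⟩ := upSlot₂_coord; obtain ⟨c0, c1, c2⟩ := upSlot₃_coord
  refine ⟨?_, ?_, ?_⟩
  · rw [inner_basalMirror_fin3, a0, a1, a2]; try ring
  · rw [inner_basalMirror_fin3, b0, b1, b2]; try ring
  · rw [inner_basalMirror_fin3, c0, c1, c2]; try ring

/-! ## The explicit steering -/

/-- **Chord algebra.**  `0 ≤ steerSteepCos c ≤ r ≤ s`, `s² = 1 − r²` (`0 ≤ c ≤ 1`) ⇒ `2 − √2 (r + s) ≤ c²`: the point of a slot's `45°`-circle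
nearest to the axis `ν` (at `⟪·, ν⟫ = (r + s)/√2`) is within chord `c` of `ν`.  (`t = cos(45°+θ)`, `t' = sin(45°+θ)`, `t + t' = √2 cos θ`,
and `r + s ≥ t + t'` on the arc.) -/
theorem chord_sq_le_of_steerSteepCos_le (c r s : ℝ) (hc0 : 0 ≤ c) (hc1 : c ≤ 1) (htr : steerSteepCos c ≤ r)
    (ht0 : 0 ≤ steerSteepCos c) (hrs : r ≤ s) (hs2 : s ^ 2 = 1 - r ^ 2) (hs0 : 0 < s) :
    2 - Real.sqrt 2 * (r + s) ≤ c ^ 2 := by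
  have h2 : Real.sqrt 2 ^ 2 = 2 := Real.sq_sqrt (by norm_num)
  have ha2 : (Real.sqrt 2 / 2) ^ 2 = 1 / 2 := by rw [div_pow, h2]; norm_num
  obtain ⟨S, hS⟩ : ∃ S : ℝ, S = c * Real.sqrt (1 - c ^ 2 / 4) := ⟨_, rfl⟩
  have hS0 : 0 ≤ S := by rw [hS]; exact mul_nonneg hc0 (Real.sqrt_nonneg _)
  have hS2 : S ^ 2 = c ^ 2 * (1 - c ^ 2 / 4) := by
    rw [hS, mul_pow, Real.sq_sqrt (by nlinarith)]
  obtain ⟨t, htdef⟩ : ∃ t : ℝ, t = steerSteepCos c := ⟨_, rfl⟩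
  obtain ⟨t', ht'⟩ : ∃ t' : ℝ, t' = Real.sqrt 2 / 2 * ((1 - c ^ 2 / 2) + S) := ⟨_, rfl⟩
  rw [← htdef] at htr ht0
  have htC : t = Real.sqrt 2 / 2 * ((1 - c ^ 2 / 2) - S) := by rw [htdef, steerSteepCos, hS]
  have hdiff : t' - t = Real.sqrt 2 * S := by rw [htC, ht']; ring
  have ht'0 : t ≤ t' := by
    have := mul_nonneg (Real.sqrt_nonneg 2) hS0
    linarith
  have htt' : t ^ 2 + t' ^ 2 = 1 := by
    rw [htC, ht']
    linear_combination (2 * ((1 - c ^ 2 / 2) ^ 2 + S ^ 2)) * ha2 + hS2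
  have hsum : t + t' = Real.sqrt 2 * (1 - c ^ 2 / 2) := by rw [htC, ht']; ring
  have ht2 : t' ^ 2 = 1 - t ^ 2 := by linarith
  have hkey : (r + s - t - t') * (s + t') = (r - t) * (s + t' - r - t) := by
    linear_combination hs2 - ht2
  have hpos : 0 < s + t' := by linarith
  have hge : t + t' ≤ r + s := by
    have hf1 : 0 ≤ r - t := sub_nonneg.2 htr
    have hf2 : 0 ≤ s + t' - r - t := by linarith [hrs, ht'0]
    have hnn : 0 ≤ (r + s - t - t') * (s + t') := by rw [hkey]; exact mul_nonneg hf1 hf2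
    by_contra hcon
    have hlt : r + s - t - t' < 0 := by linarith [lt_of_not_ge hcon]
    exact absurd (mul_neg_of_neg_of_pos hlt hpos) (not_lt.2 hnn)
  have hprod := mul_le_mul_of_nonneg_left hge (Real.sqrt_nonneg 2)
  have hval : 2 - Real.sqrt 2 * (t + t') = c ^ 2 := by
    rw [hsum]; linear_combination (-(1 - c ^ 2 / 2)) * h2
  linarith

/-- **The explicit model steering.**  Unit `v, ν` with `r = ⟪v, ν⟫ ≥ steerSteepCos c ≥ 0`, `0 ≤ c ≤ 1`: there is a unit `ζ = α v + β ν`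
(`α ≥ 0 < β`) within chord `c` of `ν` for which `v` is steep: `ζ = ν` if `r ≥ √2/2`, else the point of `v`'s `45°`-circle nearest to `ν`. -/
theorem exists_model_steering (v ν : E3) (c r : ℝ) (hv : ‖v‖ = 1) (hν : ‖ν‖ = 1) (hr : ⟪v, ν⟫_ℝ = r) (hc0 : 0 ≤ c) (hc1 : c ≤ 1)
    (htr : steerSteepCos c ≤ r) (ht0 : 0 ≤ steerSteepCos c) :
    ∃ ζ : E3, ∃ α β : ℝ, 0 ≤ α ∧ 0 < β ∧ ζ = α • v + β • ν ∧ ‖ζ‖ = 1 ∧ ‖ζ - ν‖ ≤ c ∧ Real.sqrt 2 / 2 ≤ ⟪v, ζ⟫_ℝ := by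
  by_cases hA : Real.sqrt 2 / 2 ≤ r
  · refine ⟨ν, 0, 1, le_rfl, one_pos, by rw [zero_smul, one_smul, zero_add], hν, by rw [sub_self, norm_zero]; exact hc0, ?_⟩
    rw [hr]; exact hA
  · have hA' : r < Real.sqrt 2 / 2 := lt_of_not_ge hA
    have h2 : Real.sqrt 2 ^ 2 = 2 := Real.sq_sqrt (by norm_num)
    have ha2 : (Real.sqrt 2 / 2) ^ 2 = 1 / 2 := by rw [div_pow, h2]; norm_num
    have ha0 : 0 < Real.sqrt 2 / 2 := by positivity
    have hr0 : 0 ≤ r := ht0.trans htr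
    have hr2 : r ^ 2 < 1 / 2 := by
      have := mul_self_lt_mul_self hr0 hA'
      rw [← sq, ← sq, ha2] at this; exact this
    obtain ⟨s, hsdef⟩ : ∃ s : ℝ, s = Real.sqrt (1 - r ^ 2) := ⟨_, rfl⟩
    have hs2 : s ^ 2 = 1 - r ^ 2 := by rw [hsdef]; exact Real.sq_sqrt (by linarith)
    have hs0 : 0 < s := by rw [hsdef]; exact Real.sqrt_pos.2 (by linarith)
    have hsa : Real.sqrt 2 / 2 ≤ s := by
      by_contra hcon
      have hlt : s < Real.sqrt 2 / 2 := lt_of_not_ge hcon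
      have : s ^ 2 < (Real.sqrt 2 / 2) ^ 2 := by
        rw [sq, sq]; exact mul_self_lt_mul_self hs0.le hlt
      rw [ha2, hs2] at this; linarith
    have hrs : r ≤ s := hA'.le.trans hsa
    obtain ⟨b, hb⟩ : ∃ b : ℝ, b = Real.sqrt 2 / 2 / s := ⟨_, rfl⟩
    have hb0 : 0 < b := by rw [hb]; exact div_pos ha0 hs0
    have hbs : b * s = Real.sqrt 2 / 2 := by rw [hb]; exact div_mul_cancel₀ _ hs0.ne'
    obtain ⟨α, hα⟩ : ∃ α : ℝ, α = Real.sqrt 2 / 2 - b * r := ⟨_, rfl⟩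
    have hα0 : 0 ≤ α := by
      rw [hα]; have : b * r ≤ b * s := mul_le_mul_of_nonneg_left hrs hb0.le
      linarith
    -- inner products with v and ν
    have hvv : ⟪v, v⟫_ℝ = 1 := by rw [real_inner_self_eq_norm_sq, hv, one_pow]
    have hνν : ⟪ν, ν⟫_ℝ = 1 := by rw [real_inner_self_eq_norm_sq, hν, one_pow]
    have hνv : ⟪ν, v⟫_ℝ = r := by rw [real_inner_comm, hr]
    have hvζ : ⟪v, α • v + b • ν⟫_ℝ = α + b * r := by
      rw [inner_add_right, inner_smul_right, inner_smul_right, hvv, hr]; ring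
    have hνζ : ⟪ν, α • v + b • ν⟫_ℝ = α * r + b := by
      rw [inner_add_right, inner_smul_right, inner_smul_right, hνv, hνν]; ring
    have hζζ : ⟪α • v + b • ν, α • v + b • ν⟫_ℝ = α * (α + b * r) + b * (α * r + b) := by
      rw [inner_add_left, real_inner_smul_left, real_inner_smul_left, hvζ, hνζ]
    -- ‖ζ‖ = 1
    have hζn2 : ⟪α • v + b • ν, α • v + b • ν⟫_ℝ = 1 := by
      rw [hζζ, hα]
      have : (Real.sqrt 2 / 2 - b * r) * (Real.sqrt 2 / 2 - b * r + b * r) + b * ((Real.sqrt 2 / 2 - b * r) * r + b) =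
          (Real.sqrt 2 / 2) ^ 2 + b ^ 2 * (1 - r ^ 2) := by ring
      rw [this, ← hs2, show b ^ 2 * s ^ 2 = (b * s) ^ 2 by ring, hbs, ha2]; norm_num
    have hζn : ‖α • v + b • ν‖ = 1 := by
      have h1 : ‖α • v + b • ν‖ ^ 2 = 1 ^ 2 := by rw [← real_inner_self_eq_norm_sq, hζn2, one_pow]
      exact (sq_eq_sq₀ (norm_nonneg _) zero_le_one).1 h1
    -- steepness: ⟪v, ζ⟫ = √2/2
    have hsteep : ⟪v, α • v + b • ν⟫_ℝ = Real.sqrt 2 / 2 := by rw [hvζ, hα]; ring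
    -- chord: ‖ζ − ν‖² = 2 − √2 (r + s) ≤ c²
    have hdist2 : ‖α • v + b • ν - ν‖ ^ 2 = 2 - Real.sqrt 2 * (r + s) := by
      rw [@norm_sub_sq_real, hζn, hν, real_inner_comm, hνζ, hα]
      have : (Real.sqrt 2 / 2 - b * r) * r + b = Real.sqrt 2 / 2 * r + b * (1 - r ^ 2) := by ring
      rw [this, ← hs2, show b * s ^ 2 = (b * s) * s by ring, hbs]; ring
    have hdist : ‖α • v + b • ν - ν‖ ≤ c := by
      have hle : ‖α • v + b • ν - ν‖ ^ 2 ≤ c ^ 2 := by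
        rw [hdist2]; exact chord_sq_le_of_steerSteepCos_le c r s hc0 hc1 htr ht0 hrs hs2 hs0
      exact (pow_le_pow_iff_left₀ (norm_nonneg _) hc0 two_ne_zero).1 hle
    exact ⟨α • v + b • ν, α, b, hα0, hb0, rfl, hζn, hdist, le_of_eq hsteep.symm⟩

end Summit.Ventures.Crystal3D.Cruxes.TextureLiminf.TexShadow

end
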